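import Summits.AtomisticToContinuum.HydrodynamicLimit.Theorems.OneFlightGossipEngineEnergyCurrentTailsRungHalfRhsShortTimePrelim
import HarnessLib

/-!
# Rung ½ for the crux `EnergyCurrentTails` (stmt-AtomisticToContinuum-9235), stub D
# `stub_rhsShortTime`: the right-hand side of `ContactIntensityDomination` over a short window

For the marks `φ_V(v, w) = β⁺(v)β⁻(w) + β⁺(w)β⁻(v)`, `β^±(v) = (1 − ‖v ∓ V e₁‖)₊`, the product-law
functional on the right-hand side of `ContactIntensityDomination` (two INDEPENDENT copies of the
hot-spot local Gibbs law `λ`: activity `a`, drift `0`, temperature `2 − ‖x‖`), integrated over the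
window `(0, h]`, is at most `2(2V+2) h · ((N+1)∫G⁺ + (N+1)∫G⁻ + 2 E_λ #collision times in (0,h])²`.

Proof.
* pointwise `φ_V(v,w) ‖v − w‖ ≤ (2V+2) φ_V(v,w)` (on the support `‖v − Ve₁‖, ‖w + Ve₁‖ < 1`);
* Tonelli factorises the two copies: the double integral at time `τ` is at most
  `(2V+2) · 2 B⁺(τ) B⁻(τ)` with `B^±(τ) = E_λ ∑ᵢ β^±(vᵢ(τ))`;
* `B^±(τ) ≤ (N+1) ∫ G^± + 2 E_λ #coll` for `τ ∈ (0, h]`: on a good orbit a velocity at time `τ`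
  differs from the initial one only if the particle took part in a collision during `(0, τ]`, and at
  most `2 · #(collision times in (0,h])` particles do (`rhsShortTime_sum_flow_le`); at `τ = 0` the
  one-body averages are `(N+1) ∫ G^±` (`rhsShortTime_lintegral_sum_oneBody`) — both in the companion
  file `OneFlightGossipEngineEnergyCurrentTailsRungHalfRhsShortTimePrelim`.
-/

noncomputable section

open MeasureTheory Set Filter ProbabilityTheory
open scoped ENNReal InnerProductSpace BigOperators Classical

namespace Summit.AtomisticToContinuum.HydrodynamicLimit.Theorems.EnergyCurrentTailsRungHalf

open Literature.MathematicalPhysics.KineticTheory Literature.Analysis.FluidPDE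

/-! ## The pointwise bound on the marks and the factorisation of the two copies -/

/-- On the support of `β(v − e) β(w + e)` the relative speed is at most `2‖e‖ + 2 ≤ 2V + 2`. -/
private theorem real_term_le {e v w : V3} {V : ℝ} (he : ‖e‖ ≤ V) :
    max 0 (1 - ‖v - e‖) * max 0 (1 - ‖w + e‖) * ‖v - w‖ ≤
      (2 * V + 2) * (max 0 (1 - ‖v - e‖) * max 0 (1 - ‖w + e‖)) := by
  rcases le_or_gt 1 ‖v - e‖ with hv | hv
  · rw [max_eq_left (by linarith : 1 - ‖v - e‖ ≤ 0)]
    simp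
  rcases le_or_gt 1 ‖w + e‖ with hw | hw
  · rw [max_eq_left (by linarith : 1 - ‖w + e‖ ≤ 0)]
    simp
  have hvw : ‖v - w‖ ≤ 2 * V + 2 := by
    have hdec : v - w = (v - e) - (w + e) + (2 : ℝ) • e := by
      rw [two_smul]
      abel
    rw [hdec]
    calc ‖(v - e) - (w + e) + (2 : ℝ) • e‖ ≤ ‖v - e‖ + ‖w + e‖ + ‖(2 : ℝ) • e‖ :=
          (norm_add_le _ _).trans (add_le_add (norm_sub_le _ _) le_rfl)
      _ ≤ 1 + 1 + 2 * V := by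
          rw [norm_smul, Real.norm_two]
          gcongr
      _ = 2 * V + 2 := by ring
  have hpq : 0 ≤ max 0 (1 - ‖v - e‖) * max 0 (1 - ‖w + e‖) :=
    mul_nonneg (le_max_left _ _) (le_max_left _ _)
  calc _ ≤ max 0 (1 - ‖v - e‖) * max 0 (1 - ‖w + e‖) * (2 * V + 2) :=
        mul_le_mul_of_nonneg_left hvw hpq
    _ = _ := by ring

/-- **Pointwise**: `φ_V(v, w) ‖v − w‖ ≤ (2V + 2) φ_V(v, w)` in `ℝ≥0∞`, with the products split. -/
private theorem term_le {V : ℝ} (hV : 0 ≤ V) (v w : V3) :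
    ENNReal.ofReal
          (max 0 (1 - ‖v - V • EuclideanSpace.single (0 : Fin 3) (1 : ℝ)‖) *
              max 0 (1 - ‖w + V • EuclideanSpace.single (0 : Fin 3) (1 : ℝ)‖) +
            max 0 (1 - ‖w - V • EuclideanSpace.single (0 : Fin 3) (1 : ℝ)‖) *
              max 0 (1 - ‖v + V • EuclideanSpace.single (0 : Fin 3) (1 : ℝ)‖)) *
        ENNReal.ofReal ‖v - w‖ ≤
      ENNReal.ofReal (2 * V + 2) *
        (ENNReal.ofReal (max 0 (1 - ‖v - V • EuclideanSpace.single (0 : Fin 3) (1 : ℝ)‖)) *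
            ENNReal.ofReal (max 0 (1 - ‖w + V • EuclideanSpace.single (0 : Fin 3) (1 : ℝ)‖)) +
          ENNReal.ofReal (max 0 (1 - ‖w - V • EuclideanSpace.single (0 : Fin 3) (1 : ℝ)‖)) *
            ENNReal.ofReal (max 0 (1 - ‖v + V • EuclideanSpace.single (0 : Fin 3) (1 : ℝ)‖))) := by
  set e : V3 := V • EuclideanSpace.single (0 : Fin 3) (1 : ℝ) with he_def
  have he : ‖e‖ ≤ V := by
    rw [he_def, norm_smul, Real.norm_eq_abs, abs_of_nonneg hV]
    simp
  have h0 : ∀ t : ℝ, 0 ≤ max 0 (1 - t) := fun t => le_max_left _ _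
  have hP := real_term_le (v := v) (w := w) he
  have hQ := real_term_le (v := w) (w := v) he
  rw [norm_sub_rev w v] at hQ
  rw [← ENNReal.ofReal_mul (add_nonneg (mul_nonneg (h0 _) (h0 _)) (mul_nonneg (h0 _) (h0 _))),
    ← ENNReal.ofReal_mul (h0 _), ← ENNReal.ofReal_mul (h0 _), ← ENNReal.ofReal_add
      (mul_nonneg (h0 _) (h0 _)) (mul_nonneg (h0 _) (h0 _)),
    ← ENNReal.ofReal_mul (by linarith)]
  refine ENNReal.ofReal_le_ofReal ?_
  nlinarith [hP, hQ]

/-- Algebra: `∑ᵢ ∑ⱼ c (fᵢ gⱼ + f'ⱼ g'ᵢ) = c ((∑ f)(∑ g) + (∑ f')(∑ g'))`. -/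
private theorem sum_sum_factor {n : ℕ} (c : ℝ≥0∞) (f g f' g' : Fin n → ℝ≥0∞) :
    ∑ i, ∑ j, c * (f i * g j + f' j * g' i) =
      c * ((∑ i, f i) * (∑ j, g j) + (∑ j, f' j) * ∑ i, g' i) := by
  simp_rw [← Finset.mul_sum, Finset.sum_add_distrib, Finset.sum_mul_sum]
  congr 2
  exact Finset.sum_comm

/-- Tonelli for the two independent copies:
`∫∫ (f(x) g(y) + f'(y) g'(x)) dμ(y) dμ(x) = (∫f)(∫g) + (∫f')(∫g')`. -/
private theorem lintegral_lintegral_cross {α : Type*} [MeasurableSpace α] (μ : Measure α)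
    {f g f' g' : α → ℝ≥0∞} (hf : Measurable f) (hg : Measurable g) (hf' : Measurable f')
    (hg' : Measurable g') :
    ∫⁻ x, ∫⁻ y, (f x * g y + f' y * g' x) ∂μ ∂μ =
      (∫⁻ x, f x ∂μ) * (∫⁻ y, g y ∂μ) + (∫⁻ y, f' y ∂μ) * ∫⁻ x, g' x ∂μ := by
  have h1 : ∀ x, ∫⁻ y, (f x * g y + f' y * g' x) ∂μ =
      f x * ∫⁻ y, g y ∂μ + (∫⁻ y, f' y ∂μ) * g' x := fun x => by
    rw [lintegral_add_left (hg.const_mul _), lintegral_const_mul _ hg, lintegral_mul_const _ hf']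
  simp_rw [h1]
  rw [lintegral_add_left (hf.mul_const _), lintegral_mul_const _ hf, lintegral_const_mul _ hg']

/-! ## The stub -/

/-- **Stub D (`Holds.stub_rhsShortTime`) — the right-hand side over a short window.** For the marks
`φ_V(v,w) = β⁺(v)β⁻(w) + β⁺(w)β⁻(v)`, `β^±(v) = (1 − ‖v ∓ Ve₁‖)₊`, the product-law functional of
`ContactIntensityDomination` over `(0, h]` under the hot-spot local Gibbs law is at most
`2(2V+2) h ((N+1)∫G⁺ + (N+1)∫G⁻ + 2·E#collision times in (0,h])²`. -/
theorem stub_rhsShortTime :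
    ∀ (σ : ℝ), 0 < σ → σ < 1 / 2 → ∀ (a : ℝ), 0 < a →
      ∀ (N : ℕ) (Φ : HardSphereFlow (Torus.geometry (Fin 3)) (hsDiameter σ N) (N + 1)) (V h : ℝ),
        1 ≤ V → 0 < h →
        (∫⁻ τ in Set.Ioc 0 h, (∫⁻ z, ∫⁻ z', (∑ i : Fin (N + 1), ∑ j : Fin (N + 1),
            ENNReal.ofReal
                (max 0 (1 - ‖(Φ.flow τ z i).2 - V • EuclideanSpace.single (0 : Fin 3) (1 : ℝ)‖) *
                    max 0 (1 - ‖(Φ.flow τ z' j).2 + V • EuclideanSpace.single (0 : Fin 3) (1 : ℝ)‖) +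
                  max 0 (1 - ‖(Φ.flow τ z' j).2 - V • EuclideanSpace.single (0 : Fin 3) (1 : ℝ)‖) *
                    max 0 (1 - ‖(Φ.flow τ z i).2 + V • EuclideanSpace.single (0 : Fin 3) (1 : ℝ)‖)) *
              ENNReal.ofReal ‖(Φ.flow τ z i).2 - (Φ.flow τ z' j).2‖)
            ∂(localGibbsLaw σ (fun _ => a) (fun _ => (0 : V3)) (fun x => 2 - ‖x‖) N Φ)
            ∂(localGibbsLaw σ (fun _ => a) (fun _ => (0 : V3)) (fun x => 2 - ‖x‖) N Φ))) ≤
          ENNReal.ofReal (2 * (2 * V + 2) * h) *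
            (ENNReal.ofReal (((N + 1 : ℕ) : ℝ) *
                ∫ x : T3, ∫ v, max 0 (1 - ‖v - V • EuclideanSpace.single (0 : Fin 3) (1 : ℝ)‖)
                  ∂gaussMeasure (0 : V3) (2 - ‖x‖)) +
              ENNReal.ofReal (((N + 1 : ℕ) : ℝ) *
                ∫ x : T3, ∫ v, max 0 (1 - ‖v + V • EuclideanSpace.single (0 : Fin 3) (1 : ℝ)‖)
                  ∂gaussMeasure (0 : V3) (2 - ‖x‖)) +
              2 * ∫⁻ z, ((collisionTimes (Torus.geometry (Fin 3)) (hsDiameter σ N) (fun r => Φ.flow r z) ∩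
                  Set.Ioc 0 h).ncard : ℝ≥0∞)
                ∂(localGibbsLaw σ (fun _ => a) (fun _ => (0 : V3)) (fun x => 2 - ‖x‖) N Φ)) ^ 2 := by
  intro σ _hσ hσ2 a ha N Φ V h hV _hh
  set μ := localGibbsLaw σ (fun _ => a) (fun _ => (0 : V3)) (fun x => 2 - ‖x‖) N Φ with hμ
  set e : V3 := V • EuclideanSpace.single (0 : Fin 3) (1 : ℝ) with he
  set C : ℝ≥0∞ := ∫⁻ z, ((collisionTimes (Torus.geometry (Fin 3)) (hsDiameter σ N)
    (fun r => Φ.flow r z) ∩ Set.Ioc 0 h).ncard : ℝ≥0∞) ∂μ with hC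
  set Ip : ℝ := ∫ x : T3, ∫ v, max 0 (1 - ‖v - e‖) ∂gaussMeasure (0 : V3) (2 - ‖x‖) with hIp
  set Im : ℝ := ∫ x : T3, ∫ v, max 0 (1 - ‖v + e‖) ∂gaussMeasure (0 : V3) (2 - ‖x‖) with hIm
  set S : ℝ≥0∞ := ENNReal.ofReal (((N + 1 : ℕ) : ℝ) * Ip) + ENNReal.ofReal (((N + 1 : ℕ) : ℝ) * Im) +
    2 * C with hS
  have hV0 : (0 : ℝ) ≤ V := zero_le_one.trans hV
  -- the marks `β^±`
  have hβpc : Continuous fun v : V3 => max 0 (1 - ‖v - e‖) :=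
    continuous_const.max (continuous_const.sub (continuous_id.sub continuous_const).norm)
  have hβmc : Continuous fun v : V3 => max 0 (1 - ‖v + e‖) :=
    continuous_const.max (continuous_const.sub (continuous_id.add continuous_const).norm)
  have hb0 : ∀ t : ℝ, 0 ≤ max 0 (1 - t) := fun t => le_max_left _ _
  have hb1 : ∀ w : V3, max 0 (1 - ‖w‖) ≤ 1 := fun w =>
    max_le zero_le_one (by linarith [norm_nonneg w])
  -- measurability of the sums along the flow
  have hFmeas : ∀ (τ : ℝ) (β : V3 → ℝ), Continuous β →
      Measurable fun z : Config (N + 1) (Fin 3) T3 => ∑ i, ENNReal.ofReal (β (Φ.flow τ z i).2) := by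
    intro τ β hβ
    refine Finset.measurable_sum _ fun i _ => ?_
    exact (hβ.measurable.comp ((measurable_pi_apply i).comp (Φ.measurable_flow τ)).snd).ennreal_ofReal
  -- almost every configuration is good
  have hgood : ∀ᵐ z ∂μ, z ∈ Φ.good := by
    rw [hμ, localGibbsLaw_eq]
    exact (localGibbsMeasure_absolutelyContinuous σ _ _ _ N Φ).ae_le Φ.ae_mem_good
  -- `B^±(τ) ≤ (N+1)∫G^± + 2 E#coll`
  have hB : ∀ (β : V3 → ℝ), Continuous β → (∀ v, 0 ≤ β v) → (∀ v, β v ≤ 1) →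
      ∀ τ ∈ Set.Ioc 0 h, ∫⁻ z, ∑ i, ENNReal.ofReal (β (Φ.flow τ z i).2) ∂μ ≤
        ENNReal.ofReal (((N + 1 : ℕ) : ℝ) * ∫ x : T3, ∫ v, β v ∂gaussMeasure (0 : V3) (2 - ‖x‖)) +
          2 * C := by
    intro β hβc hβ0 hβ1 τ hτ
    calc ∫⁻ z, ∑ i, ENNReal.ofReal (β (Φ.flow τ z i).2) ∂μ
        ≤ ∫⁻ z, (∑ i, ENNReal.ofReal (β (z i).2) +
            2 * ((collisionTimes (Torus.geometry (Fin 3)) (hsDiameter σ N) (fun r => Φ.flow r z) ∩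
              Set.Ioc 0 h).ncard : ℝ≥0∞)) ∂μ :=
          lintegral_mono_ae (hgood.mono fun z hz =>
            rhsShortTime_sum_flow_le N _ Φ z hz τ h hτ.1 hτ.2 β hβ1)
      _ = ∫⁻ z, ∑ i, ENNReal.ofReal (β (z i).2) ∂μ + 2 * C := by
          rw [lintegral_add_left (Finset.measurable_sum Finset.univ
            (f := fun i (z : Config (N + 1) (Fin 3) T3) => ENNReal.ofReal (β (z i).2)) fun i _ =>
            (hβc.measurable.comp (measurable_pi_apply i).snd).ennreal_ofReal),
            lintegral_const_mul' _ _ ENNReal.ofNat_ne_top]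
      _ = _ := by rw [hμ, rhsShortTime_lintegral_sum_oneBody hσ2.le ha N Φ hβc hβ0 hβ1]
  -- the double integral at a fixed time `τ ∈ (0, h]`
  have hinner : ∀ τ ∈ Set.Ioc 0 h,
      (∫⁻ z, ∫⁻ z', (∑ i : Fin (N + 1), ∑ j : Fin (N + 1),
          ENNReal.ofReal (max 0 (1 - ‖(Φ.flow τ z i).2 - e‖) * max 0 (1 - ‖(Φ.flow τ z' j).2 + e‖) +
              max 0 (1 - ‖(Φ.flow τ z' j).2 - e‖) * max 0 (1 - ‖(Φ.flow τ z i).2 + e‖)) *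
            ENNReal.ofReal ‖(Φ.flow τ z i).2 - (Φ.flow τ z' j).2‖) ∂μ ∂μ) ≤
        ENNReal.ofReal (2 * V + 2) * (2 * S ^ 2) := by
    intro τ hτ
    set Fp : Config (N + 1) (Fin 3) T3 → ℝ≥0∞ := fun z =>
      ∑ i, ENNReal.ofReal (max 0 (1 - ‖(Φ.flow τ z i).2 - e‖)) with hFp
    set Fm : Config (N + 1) (Fin 3) T3 → ℝ≥0∞ := fun z =>
      ∑ i, ENNReal.ofReal (max 0 (1 - ‖(Φ.flow τ z i).2 + e‖)) with hFm
    have hFpm : Measurable Fp := hFmeas τ _ hβpc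
    have hFmm : Measurable Fm := hFmeas τ _ hβmc
    have hBp : ∫⁻ z, Fp z ∂μ ≤ ENNReal.ofReal (((N + 1 : ℕ) : ℝ) * Ip) + 2 * C :=
      hB _ hβpc (fun v => hb0 _) (fun v => hb1 _) τ hτ
    have hBm : ∫⁻ z, Fm z ∂μ ≤ ENNReal.ofReal (((N + 1 : ℕ) : ℝ) * Im) + 2 * C :=
      hB _ hβmc (fun v => hb0 _) (fun v => hb1 _) τ hτ
    have hprod : (∫⁻ z, Fp z ∂μ) * (∫⁻ z, Fm z ∂μ) ≤ S ^ 2 := by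
      rw [sq]
      refine mul_le_mul' (hBp.trans ?_) (hBm.trans ?_)
      · exact add_le_add (le_add_right le_rfl) le_rfl
      · exact add_le_add le_add_self le_rfl
    have hpt : ∀ z z' : Config (N + 1) (Fin 3) T3,
        (∑ i : Fin (N + 1), ∑ j : Fin (N + 1),
          ENNReal.ofReal (max 0 (1 - ‖(Φ.flow τ z i).2 - e‖) * max 0 (1 - ‖(Φ.flow τ z' j).2 + e‖) +
              max 0 (1 - ‖(Φ.flow τ z' j).2 - e‖) * max 0 (1 - ‖(Φ.flow τ z i).2 + e‖)) *
            ENNReal.ofReal ‖(Φ.flow τ z i).2 - (Φ.flow τ z' j).2‖) ≤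
          ENNReal.ofReal (2 * V + 2) * (Fp z * Fm z' + Fp z' * Fm z) := by
      intro z z'
      calc _ ≤ ∑ i : Fin (N + 1), ∑ j : Fin (N + 1), ENNReal.ofReal (2 * V + 2) *
            (ENNReal.ofReal (max 0 (1 - ‖(Φ.flow τ z i).2 - e‖)) *
                ENNReal.ofReal (max 0 (1 - ‖(Φ.flow τ z' j).2 + e‖)) +
              ENNReal.ofReal (max 0 (1 - ‖(Φ.flow τ z' j).2 - e‖)) *
                ENNReal.ofReal (max 0 (1 - ‖(Φ.flow τ z i).2 + e‖))) :=
            Finset.sum_le_sum fun i _ => Finset.sum_le_sum fun j _ => term_le hV0 _ _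
        _ = _ := sum_sum_factor _ _ _ _ _
    calc _ ≤ ∫⁻ z, ∫⁻ z', ENNReal.ofReal (2 * V + 2) * (Fp z * Fm z' + Fp z' * Fm z) ∂μ ∂μ :=
          lintegral_mono fun z => lintegral_mono fun z' => hpt z z'
      _ = ENNReal.ofReal (2 * V + 2) *
            ((∫⁻ z, Fp z ∂μ) * (∫⁻ z, Fm z ∂μ) + (∫⁻ z, Fp z ∂μ) * ∫⁻ z, Fm z ∂μ) := by
          simp_rw [lintegral_const_mul' (ENNReal.ofReal (2 * V + 2)) _ ENNReal.ofReal_ne_top]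
          rw [lintegral_lintegral_cross μ hFpm hFmm hFpm hFmm]
      _ ≤ ENNReal.ofReal (2 * V + 2) * (2 * S ^ 2) := by
          rw [← two_mul]
          exact mul_le_mul' le_rfl (mul_le_mul' le_rfl hprod)
  -- integrate over the window
  calc _ ≤ ∫⁻ _τ in Set.Ioc 0 h, ENNReal.ofReal (2 * V + 2) * (2 * S ^ 2) :=
        setLIntegral_mono' measurableSet_Ioc fun τ hτ => hinner τ hτ
    _ = ENNReal.ofReal (2 * (2 * V + 2) * h) * S ^ 2 := by
        rw [setLIntegral_const, Real.volume_Ioc, sub_zero,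
          show (2 : ℝ) * (2 * V + 2) * h = (2 * V + 2) * (2 * h) by ring,
          ENNReal.ofReal_mul (by linarith : (0 : ℝ) ≤ 2 * V + 2),
          ENNReal.ofReal_mul (by norm_num : (0 : ℝ) ≤ 2), ENNReal.ofReal_ofNat]
        ring

end Summit.AtomisticToContinuum.HydrodynamicLimit.Theorems.EnergyCurrentTailsRungHalf

end
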